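import Summits.Ventures.HodgeRepro2.T5SU11KernelDerivative
import Summits.Ventures.HodgeRepro2.T5SU11ResolventSymmetricClass
import Summits.Ventures.HodgeRepro2.T5SU11ResolventNeumann

/-!
# The composed kernels are symmetric: `K_λ^{∘(n+1)}(t, s) = K_λ^{∘(n+1)}(s, t)`

The composed kernel `K_λ^{∘(n+1)}(t, s) = (G^I_λ)ⁿ K_λ(·, s)(t)` is the pairing `⟨K_λ(t, ·), (G^I_λ)^{n−1} K_λ(·, s)⟩` of two
class sources of rates `> 1` (the kernel sources decay at the rate `λ > 1`, row 5xx; the iterates at rates in `(1, λ)`,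
row 503), so row 523's symmetry `⟨G^I_λ g, h⟩ = ⟨g, G^I_λ h⟩` moves the resolvents across one by one:

* `inner_iterate_eq` — **`⟨f, (G^I_λ)ⁿ K_λ(·, s)⟩ = ⟨(G^I_λ)ⁿ f, K_λ(·, s)⟩`** for every source `f` of the class at a rate `> 1`;
* `kernel_comp_symm` — **`(G^I_λ)ⁿ K_λ(·, s)(t) = (G^I_λ)ⁿ K_λ(·, t)(s)`** for every `n` and `t, s > 0`: all the composed
  kernels — hence all the Taylor coefficients of the kernel in the spectral parameter (row 580) — are symmetric.

Nothing is claimed about (N).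

Blind lane: Mathlib + the HodgeRepro2 prefix only; no sorry; axioms ⊆ {propext, Classical.choice,
Quot.sound}.
-/

namespace Summit.Ventures.HodgeRepro2.T5SU11KernelCompositionSymmetric

open Filter Topology MeasureTheory
open Set (Ioi Ioc)
open T5SU11Cartan T5SU11SphericalFunction T5SU11SphericalDecay T5SU11RadialGreenKernel T5SU11RadialGreenImproper
  T5SU11RadialGreenImproperDecaySource T5SU11RadialGreenImproperStable T5SU11ResolventKernelComposition
  T5SU11KernelDifferenceRegularity T5SU11ResolventSymmetricClass T5SU11ResolventNeumann T5SU11KernelDerivative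

section measure

variable [MeasurableSpace Circle] [BorelSpace Circle]

variable {lam : ℝ} (hlam : 1 < lam) {s : ℝ} (hs : 0 < s)

include hlam hs in
/-- **The resolvents move across the pairing with the kernel source**: for every source `f` of the class at a rate
`ε > 1`, `∫ f · (G^I_λ)ⁿ K_λ(·, s) sinh 2r = ∫ (G^I_λ)ⁿ f · K_λ(·, s) sinh 2r`. -/
theorem inner_iterate_eq (n : ℕ) :
    ∀ (f : ℝ → ℝ) (M ε C s₀ : ℝ), ContinuousOn f (Ioi 0) → (∀ r ∈ Ioc (0 : ℝ) 1, |f r| ≤ M) → 0 ≤ M →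
      2 - lam < ε → 1 < ε → (∀ r, s₀ ≤ r → |f r| ≤ C * Real.exp (-ε * r)) →
      ∫ r in Ioi 0, f r * ((greenSolI (fun t => sph lam (hyp t)) (sphDecay lam))^[n] (fun r => sphGreenKernel lam r s)) r
          * Real.sinh (2 * r)
        = ∫ r in Ioi 0, ((greenSolI (fun t => sph lam (hyp t)) (sphDecay lam))^[n] f) r * sphGreenKernel lam r s
          * Real.sinh (2 * r) := by
  -- the class data of the kernel source `k_s` (rate `λ > 1`)
  obtain ⟨Ms, hMs0, hMs⟩ := kernel_source_bounded hlam hs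
  obtain ⟨Cs, s₀s, hCs⟩ := kernel_source_decay hlam hs
  have hks := kernel_source_continuousOn hlam hs
  have hεs : 2 - lam < lam := by linarith
  induction n with
  | zero => intro f M ε C s₀ _ _ _ _ _ _; rfl
  | succ n ih =>
    intro f M ε C s₀ hf hM hM0 hε hε1 hC
    -- the class data of `(G^I_λ)ⁿ k_s` at the rate `(1 + λ)/2 ∈ (1, λ)` (row 503)
    obtain ⟨hcs, ⟨Ms', hMs'0, hMs'⟩, hds⟩ := iterate_class (lam₂ := lam) hlam hks hMs hMs0 hεs hCs n
    obtain ⟨Ks, Ts, _, _, hKs⟩ := hds ((1 + lam) / 2) (by rw [min_self]; linarith)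
    -- the class data of `G^I_λ f` at the rate `(1 + min(ε, λ))/2 ∈ (1, min(ε, λ))` (row 499)
    have hmin : 1 < min ε lam := lt_min hε1 hlam
    have hcf := continuousOn_greenSolI hlam hf hM hM0 hε hC
    obtain ⟨Mf', hMf'0, hMf'⟩ := exists_abs_greenSolI_le_of_le_one hlam hf hM hM0 hε hC
    obtain ⟨Kf, Tf, _, _, hKf⟩ := exists_abs_greenSolI_le_exp hlam hf hM hM0 hε hC
      (ε' := (1 + min ε lam) / 2) (by linarith)
    have hεf : 2 - lam < (1 + min ε lam) / 2 := by linarith [min_le_right ε lam]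
    have hεf1 : 1 < (1 + min ε lam) / 2 := by linarith
    -- one resolvent across: `⟨f, G (Gⁿ k_s)⟩ = ⟨G f, Gⁿ k_s⟩` (row 523)
    have hsym := inner_greenSolI_symm hlam hf hM hM0 hC hcs hMs' hMs'0 hKs hε1 (by linarith : 1 < (1 + lam) / 2)
    rw [Function.iterate_succ_apply', ← hsym]
    -- the induction hypothesis on `G^I_λ f`, and `(G^I_λ)^{n+1} f = (G^I_λ)ⁿ (G^I_λ f)`
    rw [Function.iterate_succ_apply]
    exact ih (greenSolI (fun t => sph lam (hyp t)) (sphDecay lam) f) Mf' ((1 + min ε lam) / 2) Kf Tf hcf hMf' hMf'0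
      hεf hεf1 hKf

include hlam in
/-- **THE COMPOSED KERNELS ARE SYMMETRIC**: `(G^I_λ)ⁿ K_λ(·, s)(t) = (G^I_λ)ⁿ K_λ(·, t)(s)` for every `n` and `t, s > 0`. -/
theorem kernel_comp_symm (n : ℕ) {t s : ℝ} (ht : 0 < t) (hs : 0 < s) :
    ((greenSolI (fun t => sph lam (hyp t)) (sphDecay lam))^[n] (fun r => sphGreenKernel lam r s)) t
      = ((greenSolI (fun t => sph lam (hyp t)) (sphDecay lam))^[n] (fun r => sphGreenKernel lam r t)) s := by
  cases n with
  | zero => exact sphGreenKernel_symm lam t s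
  | succ n =>
    -- the class data of `(G^I_λ)ⁿ k_s` and `(G^I_λ)ⁿ k_t`
    obtain ⟨Ms, hMs0, hMs⟩ := kernel_source_bounded hlam hs
    obtain ⟨Cs, s₀s, hCs⟩ := kernel_source_decay hlam hs
    have hks := kernel_source_continuousOn hlam hs
    obtain ⟨Mt, hMt0, hMt⟩ := kernel_source_bounded hlam ht
    obtain ⟨Ct, s₀t, hCt⟩ := kernel_source_decay hlam ht
    have hkt := kernel_source_continuousOn hlam ht
    have hε : 2 - lam < lam := by linarith
    obtain ⟨hcs, ⟨Ms', hMs'0, hMs'⟩, hds⟩ := iterate_class (lam₂ := lam) hlam hks hMs hMs0 hε hCs n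
    obtain ⟨Ks, Ts, _, _, hKs⟩ := hds ((1 + lam) / 2) (by rw [min_self]; linarith)
    obtain ⟨hct, ⟨Mt', hMt'0, hMt'⟩, hdt⟩ := iterate_class (lam₂ := lam) hlam hkt hMt hMt0 hε hCt n
    obtain ⟨Kt, Tt, _, _, hKt⟩ := hdt ((1 + lam) / 2) (by rw [min_self]; linarith)
    have hεh : 2 - lam < (1 + lam) / 2 := by linarith
    -- the kernel representations of the outer resolvents
    have hBs := integrableOn_sph_mul_mul_sinh_Ioc hcs hMs' hMs'0 lam
    have hAs := integrableOn_sphDecay_mul_mul_sinh hlam hcs hMs' hMs'0 hεh hKs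
    have hBt := integrableOn_sph_mul_mul_sinh_Ioc hct hMt' hMt'0 lam
    have hAt := integrableOn_sphDecay_mul_mul_sinh hlam hct hMt' hMt'0 hεh hKt
    rw [Function.iterate_succ_apply', Function.iterate_succ_apply', greenSolI_eq_integral_kernel hBs hAs ht,
      greenSolI_eq_integral_kernel hBt hAt hs]
    -- `⟨k_t, Gⁿ k_s⟩ = ⟨Gⁿ k_t, k_s⟩` with `k_t` the class source `r ↦ K_λ(t, r) = K_λ(r, t)`
    have h := inner_iterate_eq hlam hs n (fun r => sphGreenKernel lam r t) Mt lam Ct s₀t hkt hMt hMt0 hε hlam hCt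
    have e1 : ∫ r in Ioi 0, greenKernel (fun t => sph lam (hyp t)) (sphDecay lam) t r
          * ((greenSolI (fun t => sph lam (hyp t)) (sphDecay lam))^[n] (fun r => sphGreenKernel lam r s)) r
          * Real.sinh (2 * r)
        = ∫ r in Ioi 0, (fun r => sphGreenKernel lam r t) r
          * ((greenSolI (fun t => sph lam (hyp t)) (sphDecay lam))^[n] (fun r => sphGreenKernel lam r s)) r
          * Real.sinh (2 * r) := by
      apply setIntegral_congr_fun measurableSet_Ioi
      intro r _
      simp only [sphGreenKernel]
      rw [greenKernel_symm (fun t => sph lam (hyp t)) (sphDecay lam) t r]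
    have e2 : ∫ r in Ioi 0, greenKernel (fun t => sph lam (hyp t)) (sphDecay lam) s r
          * ((greenSolI (fun t => sph lam (hyp t)) (sphDecay lam))^[n] (fun r => sphGreenKernel lam r t)) r
          * Real.sinh (2 * r)
        = ∫ r in Ioi 0, ((greenSolI (fun t => sph lam (hyp t)) (sphDecay lam))^[n] (fun r => sphGreenKernel lam r t)) r
          * sphGreenKernel lam r s * Real.sinh (2 * r) := by
      apply setIntegral_congr_fun measurableSet_Ioi
      intro r _
      simp only [sphGreenKernel]
      rw [greenKernel_symm (fun t => sph lam (hyp t)) (sphDecay lam) s r]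
      ring
    rw [e1, e2]
    exact h

end measure

end Summit.Ventures.HodgeRepro2.T5SU11KernelCompositionSymmetric
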